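import Summits.KontsevichZagierPeriods.KontsevichZagierPeriods.Theorems.MzvKernelInKZ.Negative.ShuffleCells
import Summits.KontsevichZagierPeriods.KontsevichZagierPeriods.Theorems.MzvKernelInKZ.Negative.Divergence

/-!
# `MzvKernelInKZ` (stmt-KontsevichZagierPeriods-3914): negative side — the shuffle `ζ(2)² = 2ζ(2,2) + 4ζ(3,1)` and `ζ(4) = 4ζ(3,1)` are move chains

Companion of `Negative/ShuffleCells.lean`.  **THE SHUFFLE AT WEIGHT 4 IS A KZ MOVE CHAIN**
(`cShuffle4_mem_relations`: `[Δ₂×Δ₂, ω₀₁⊗ω₀₁] − [Δ₄, 2ω₀₁₀₁] − [Δ₄, 4ω₀₀₁₁] ∈ KZ.relations`):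
the six cells are peeled off the product domain one at a time by domain additivity (rule (1a)) with
DISJOINT pieces (`peel`), what is left lies in four coordinate hyperplanes (`T6_subset_walls`,
trichotomy) and is Lebesgue-null (`Measure.addHaar_submodule`), hence a relation
(`KZ.of_mem_levelRel_of_volume_eq_zero`); the cells are word representations (`ShuffleCells.lean`)
and coefficients merge by integrand additivity.  With the stuffle (`StuffleFour.lean`) the product
representation cancels: **`ζ(4) = 4ζ(3,1)` IS A MOVE CHAIN** (`cFds4_mem_relations`, the finite
double shuffle at weight 4 — the crux's named "first test", and route Grothendieck's item
`GpcZeta4Eq4zeta31`, stmt-0275, whose inlined simplex is `setOf_chain_eq_simplex`), with absolutely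
convergent rational intermediates throughout and no use of the value `ζ(2)²`.  Consequence for the
crux: its weight-4 rung is the single typed membership `cEuler4 ∈ relations`
(`weightKernel_four_iff_euler`; equivalently Hoffman's relation, `weightKernel_four_iff_hoffman`).

Sources: K. Ihara, M. Kaneko, D. Zagier, *Derivation and double shuffle relations for multiple zeta
values*, Compos. Math. 142 (2006), §1 (finite double shuffle); M. Eie (2013), §1.2;
M. Kontsevich, D. Zagier, *Periods* (2001), §1.2 rules (1a), (2).
-/

noncomputable section

namespace Summit.KontsevichZagierPeriods.MzvKernelInKZ.Negative

open Set MeasureTheory MvPolynomial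
open Literature.NumberTheory.Transcendental
open Summit.KontsevichZagierPeriods.KontsevichZagierPeriods.Theses.LinRedNormalForm (MzvKernelInKZ)
open Literature.ModelTheory.ExponentialFields (IsSemialgebraic)

/-! ### Peeling the six cells off `Δ₂ × Δ₂` (rule 1a, disjoint pieces), the remainder is null -/

/-- One peeling step: for a semialgebraic `T ⊆ P22.domain` and a cell `cell a ⊆ T`,
`[T] − [cell a] − [T ∖ cell a]` is a domain-additivity move. [folklore] -/
theorem peel {T : Set (Fin 4 → ℝ)} (hT : IsSemialgebraic ℚ T) (hTD : T ⊆ P22.domain)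
    (a : Fin 4 → Fin 4) (ha : cell a ⊆ T) :
    KZ.of (P22.restrict T hT hTD) - KZ.of (cellRep a) -
      KZ.of (P22.restrict (T \ cell a) (hT.diff (isSemialgebraic_cell a)) (Set.sdiff_subset.trans hTD)) ∈
      KZ.domainAddRel := by
  refine ⟨4, P22.restrict T hT hTD, cellRep a, P22.restrict (T \ cell a) (hT.diff (isSemialgebraic_cell a))
    (Set.sdiff_subset.trans hTD), ?_, ?_, fun _ _ => rfl, fun _ _ => rfl, rfl⟩
  · change T = cell a ∪ (T \ cell a)
    rw [Set.union_sdiff_cancel ha]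
  · change volume (cell a ∩ (T \ cell a)) = 0
    rw [Set.inter_sdiff_self, measure_empty]

/-- The remainders. [folklore] -/
def T1 : Set (Fin 4 → ℝ) := P22.domain \ cell aA
/-- Remainder after peeling cells `A, B`. [folklore] -/
def T2 : Set (Fin 4 → ℝ) := T1 \ cell aB
/-- Remainder after peeling cells `A, B, C`. [folklore] -/
def T3 : Set (Fin 4 → ℝ) := T2 \ cell aC
/-- Remainder after peeling cells `A`–`D`. [folklore] -/
def T4 : Set (Fin 4 → ℝ) := T3 \ cell aD
/-- Remainder after peeling cells `A`–`E`. [folklore] -/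
def T5 : Set (Fin 4 → ℝ) := T4 \ cell aE
/-- Remainder after peeling all six cells. [folklore] -/
def T6 : Set (Fin 4 → ℝ) := T5 \ cell aF

/-- `T1` is semialgebraic. [folklore] -/
theorem sa_T1 : IsSemialgebraic ℚ T1 := P22.isSemialgebraic_domain.diff (isSemialgebraic_cell _)
/-- `T2` is semialgebraic. [folklore] -/
theorem sa_T2 : IsSemialgebraic ℚ T2 := sa_T1.diff (isSemialgebraic_cell _)
/-- `T3` is semialgebraic. [folklore] -/
theorem sa_T3 : IsSemialgebraic ℚ T3 := sa_T2.diff (isSemialgebraic_cell _)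
/-- `T4` is semialgebraic. [folklore] -/
theorem sa_T4 : IsSemialgebraic ℚ T4 := sa_T3.diff (isSemialgebraic_cell _)
/-- `T5` is semialgebraic. [folklore] -/
theorem sa_T5 : IsSemialgebraic ℚ T5 := sa_T4.diff (isSemialgebraic_cell _)
/-- `T6` is semialgebraic. [folklore] -/
theorem sa_T6 : IsSemialgebraic ℚ T6 := sa_T5.diff (isSemialgebraic_cell _)

/-- `T1 ⊆ Δ₂ × Δ₂`. [folklore] -/
theorem T1_sub : T1 ⊆ P22.domain := Set.sdiff_subset
/-- `T2 ⊆ Δ₂ × Δ₂`. [folklore] -/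
theorem T2_sub : T2 ⊆ P22.domain := Set.sdiff_subset.trans T1_sub
/-- `T3 ⊆ Δ₂ × Δ₂`. [folklore] -/
theorem T3_sub : T3 ⊆ P22.domain := Set.sdiff_subset.trans T2_sub
/-- `T4 ⊆ Δ₂ × Δ₂`. [folklore] -/
theorem T4_sub : T4 ⊆ P22.domain := Set.sdiff_subset.trans T3_sub
/-- `T5 ⊆ Δ₂ × Δ₂`. [folklore] -/
theorem T5_sub : T5 ⊆ P22.domain := Set.sdiff_subset.trans T4_sub
/-- `T6 ⊆ Δ₂ × Δ₂`. [folklore] -/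
theorem T6_sub : T6 ⊆ P22.domain := Set.sdiff_subset.trans T5_sub

/-- Unfolded cell memberships. [folklore] -/
theorem mem_cellA {z : Fin 4 → ℝ} : z ∈ cell aA ↔ z ∈ P22.domain ∧ z 1 < z 0 ∧ z 2 < z 1 ∧ z 3 < z 2 := by
  simp [mem_cell, aA]
/-- Membership in cell `B`, unfolded. [folklore] -/
theorem mem_cellB {z : Fin 4 → ℝ} : z ∈ cell aB ↔ z ∈ P22.domain ∧ z 2 < z 0 ∧ z 1 < z 2 ∧ z 3 < z 1 := by
  simp [mem_cell, aB]
/-- Membership in cell `C`, unfolded. [folklore] -/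
theorem mem_cellC {z : Fin 4 → ℝ} : z ∈ cell aC ↔ z ∈ P22.domain ∧ z 2 < z 0 ∧ z 3 < z 2 ∧ z 1 < z 3 := by
  simp [mem_cell, aC]
/-- Membership in cell `D`, unfolded. [folklore] -/
theorem mem_cellD {z : Fin 4 → ℝ} : z ∈ cell aD ↔ z ∈ P22.domain ∧ z 0 < z 2 ∧ z 1 < z 0 ∧ z 3 < z 1 := by
  simp [mem_cell, aD]
/-- Membership in cell `E`, unfolded. [folklore] -/
theorem mem_cellE {z : Fin 4 → ℝ} : z ∈ cell aE ↔ z ∈ P22.domain ∧ z 0 < z 2 ∧ z 3 < z 0 ∧ z 1 < z 3 := by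
  simp [mem_cell, aE]
/-- Membership in cell `F`, unfolded. [folklore] -/
theorem mem_cellF {z : Fin 4 → ℝ} : z ∈ cell aF ↔ z ∈ P22.domain ∧ z 3 < z 2 ∧ z 0 < z 3 ∧ z 1 < z 0 := by
  simp [mem_cell, aF]

/-- Cell `B` survives the first peeling. [folklore] -/
theorem cellB_sub_T1 : cell aB ⊆ T1 := by
  intro z hz
  obtain ⟨hD, b1, b2, b3⟩ := mem_cellB.mp hz
  refine ⟨hD, fun hA => ?_⟩
  obtain ⟨-, a1, a2, a3⟩ := mem_cellA.mp hA
  linarith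

/-- Cell `C` survives the first two peelings. [folklore] -/
theorem cellC_sub_T2 : cell aC ⊆ T2 := by
  intro z hz
  obtain ⟨hD, c1, c2, c3⟩ := mem_cellC.mp hz
  refine ⟨⟨hD, fun hA => ?_⟩, fun hB => ?_⟩
  · obtain ⟨-, a1, a2, a3⟩ := mem_cellA.mp hA; linarith
  · obtain ⟨-, b1, b2, b3⟩ := mem_cellB.mp hB; linarith

/-- Cell `D` survives the first three peelings. [folklore] -/
theorem cellD_sub_T3 : cell aD ⊆ T3 := by
  intro z hz
  obtain ⟨hD, d1, d2, d3⟩ := mem_cellD.mp hz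
  refine ⟨⟨⟨hD, fun hA => ?_⟩, fun hB => ?_⟩, fun hC => ?_⟩
  · obtain ⟨-, a1, a2, a3⟩ := mem_cellA.mp hA; linarith
  · obtain ⟨-, b1, b2, b3⟩ := mem_cellB.mp hB; linarith
  · obtain ⟨-, c1, c2, c3⟩ := mem_cellC.mp hC; linarith

/-- Cell `E` survives the first four peelings. [folklore] -/
theorem cellE_sub_T4 : cell aE ⊆ T4 := by
  intro z hz
  obtain ⟨hD, e1, e2, e3⟩ := mem_cellE.mp hz
  refine ⟨⟨⟨⟨hD, fun hA => ?_⟩, fun hB => ?_⟩, fun hC => ?_⟩, fun hD' => ?_⟩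
  · obtain ⟨-, a1, a2, a3⟩ := mem_cellA.mp hA; linarith
  · obtain ⟨-, b1, b2, b3⟩ := mem_cellB.mp hB; linarith
  · obtain ⟨-, c1, c2, c3⟩ := mem_cellC.mp hC; linarith
  · obtain ⟨-, d1, d2, d3⟩ := mem_cellD.mp hD'; linarith

/-- Cell `F` survives the first five peelings. [folklore] -/
theorem cellF_sub_T5 : cell aF ⊆ T5 := by
  intro z hz
  obtain ⟨hD, f1, f2, f3⟩ := mem_cellF.mp hz
  refine ⟨⟨⟨⟨⟨hD, fun hA => ?_⟩, fun hB => ?_⟩, fun hC => ?_⟩, fun hD' => ?_⟩, fun hE => ?_⟩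
  · obtain ⟨-, a1, a2, a3⟩ := mem_cellA.mp hA; linarith
  · obtain ⟨-, b1, b2, b3⟩ := mem_cellB.mp hB; linarith
  · obtain ⟨-, c1, c2, c3⟩ := mem_cellC.mp hC; linarith
  · obtain ⟨-, d1, d2, d3⟩ := mem_cellD.mp hD'; linarith
  · obtain ⟨-, e1, e2, e3⟩ := mem_cellE.mp hE; linarith

/-- The ties (walls) `zᵢ = zⱼ` between the two factors. [folklore] -/
def walls : Set (Fin 4 → ℝ) := {z | z 1 = z 2} ∪ {z | z 0 = z 2} ∪ {z | z 1 = z 3} ∪ {z | z 0 = z 3}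

/-- **What is left after the six cells is contained in the walls** (trichotomy). [folklore] -/
theorem T6_subset_walls : T6 ⊆ walls := by
  intro z hz
  obtain ⟨⟨⟨⟨⟨⟨hD, nA⟩, nB⟩, nC⟩, nD⟩, nE⟩, nF⟩ := hz
  obtain ⟨⟨-, -, -, -, h10⟩, ⟨-, -, -, -, h32⟩⟩ := mem_P22_domain.mp hD
  simp only [walls, mem_union, mem_setOf_eq]
  by_contra hw
  simp only [not_or] at hw
  obtain ⟨⟨⟨w12, w02⟩, w13⟩, w03⟩ := hw
  rcases lt_or_gt_of_ne w12 with h12 | h12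
  · -- z1 < z2
    rcases lt_or_gt_of_ne w02 with h02 | h02
    · -- z0 < z2
      rcases lt_or_gt_of_ne w03 with h03 | h03
      · exact nF (mem_cellF.mpr ⟨hD, h32, h03, h10⟩)
      · rcases lt_or_gt_of_ne w13 with h13 | h13
        · exact nE (mem_cellE.mpr ⟨hD, h02, h03, h13⟩)
        · exact nD (mem_cellD.mpr ⟨hD, h02, h10, h13⟩)
    · -- z2 < z0
      rcases lt_or_gt_of_ne w13 with h13 | h13
      · exact nC (mem_cellC.mpr ⟨hD, h02, h32, h13⟩)
      · exact nB (mem_cellB.mpr ⟨hD, h02, h12, h13⟩)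
  · -- z2 < z1
    exact nA (mem_cellA.mpr ⟨hD, h10, h12, h32⟩)

/-- A coordinate hyperplane `zᵢ = zⱼ` (`i ≠ j`) is Lebesgue-null. [folklore] -/
theorem volume_setOf_eq_zero {i j : Fin 4} (hij : i ≠ j) :
    volume {z : Fin 4 → ℝ | z i = z j} = 0 := by
  let L : (Fin 4 → ℝ) →ₗ[ℝ] ℝ :=
    LinearMap.proj (R := ℝ) (φ := fun _ : Fin 4 => ℝ) i - LinearMap.proj (R := ℝ) (φ := fun _ : Fin 4 => ℝ) j
  have hker : {z : Fin 4 → ℝ | z i = z j} = (LinearMap.ker L : Set (Fin 4 → ℝ)) := by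
    ext z
    simp [L, sub_eq_zero]
  rw [hker]
  refine Measure.addHaar_submodule volume (LinearMap.ker L) ?_
  intro htop
  have hmem : (Pi.single i (1 : ℝ) : Fin 4 → ℝ) ∈ LinearMap.ker L := by rw [htop]; trivial
  have : (Pi.single i (1 : ℝ) : Fin 4 → ℝ) i = (Pi.single i (1 : ℝ) : Fin 4 → ℝ) j := by
    simpa [L, sub_eq_zero] using hmem
  simp [hij.symm] at this

/-- The walls are Lebesgue-null. [folklore] -/
theorem volume_walls : volume walls = 0 := by
  simp only [walls]
  refine measure_union_null (measure_union_null (measure_union_null ?_ ?_) ?_) ?_ <;>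
    exact volume_setOf_eq_zero (by decide)

/-- The final remainder is Lebesgue-null. [folklore] -/
theorem volume_T6 : volume T6 = 0 := measure_mono_null T6_subset_walls volume_walls

/-- The null remainder is a relation. [folklore] -/
theorem restrict_T6_mem : KZ.of (P22.restrict T6 sa_T6 T6_sub) ∈ KZ.relations :=
  KZ.levelRel_le_relations (KZ.of_mem_levelRel_of_volume_eq_zero _ volume_T6)

/-! ### Assembly of the shuffle -/

/-- The shuffle element `[Δ₂×Δ₂, ω₀₁⊗ω₀₁] − [Δ₄, 2ω₀₁₀₁] − [Δ₄, 4ω₀₀₁₁]`. [folklore] -/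
def cShuffle4 : KZ.FormalRep :=
  KZ.of P22 - KZ.of (wordRep ω22 2 adm_ω22) - KZ.of (wordRep ω31 4 adm_ω31)

/-- `P22.restrict P22.domain = P22`. [folklore] -/
theorem restrict_self : P22.restrict P22.domain P22.isSemialgebraic_domain subset_rfl = P22 :=
  KZ.IntegralRep.ext' rfl rfl

/-- **THE SHUFFLE AT WEIGHT 4 IS A MOVE CHAIN** (six domain additivities with disjoint pieces, six
coordinate permutations, one null remainder, bookkeeping): `cShuffle4 ∈ KZ.relations`. [folklore] -/
theorem cShuffle4_mem_relations : cShuffle4 ∈ KZ.relations := by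
  have p1 := KZ.domainAddRel_subset_relations
    (peel P22.isSemialgebraic_domain subset_rfl aA (cell_subset aA))
  rw [restrict_self] at p1
  have p2 := KZ.domainAddRel_subset_relations (peel sa_T1 T1_sub aB cellB_sub_T1)
  have p3 := KZ.domainAddRel_subset_relations (peel sa_T2 T2_sub aC cellC_sub_T2)
  have p4 := KZ.domainAddRel_subset_relations (peel sa_T3 T3_sub aD cellD_sub_T3)
  have p5 := KZ.domainAddRel_subset_relations (peel sa_T4 T4_sub aE cellE_sub_T4)
  have p6 := KZ.domainAddRel_subset_relations (peel sa_T5 T5_sub aF cellF_sub_T5)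
  have p7 := restrict_T6_mem
  have qA := cellA_equiv
  have qB := cellB_equiv
  have qC := cellC_equiv
  have qD := cellD_equiv
  have qE := cellE_equiv
  have qF := cellF_equiv
  have r22 := of_wordRep_add ω22 1 1 adm_ω22
  have r31a := of_wordRep_add ω31 1 1 adm_ω31
  have r31b := of_wordRep_add ω31 2 2 adm_ω31
  norm_num at r22 r31a r31b
  -- abbreviations for readability
  set P := KZ.of P22
  set A := KZ.of (cellRep aA); set B := KZ.of (cellRep aB); set C := KZ.of (cellRep aC)
  set D := KZ.of (cellRep aD); set E := KZ.of (cellRep aE); set F := KZ.of (cellRep aF)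
  set R1 := KZ.of (P22.restrict T1 sa_T1 T1_sub)
  set R2 := KZ.of (P22.restrict T2 sa_T2 T2_sub)
  set R3 := KZ.of (P22.restrict T3 sa_T3 T3_sub)
  set R4 := KZ.of (P22.restrict T4 sa_T4 T4_sub)
  set R5 := KZ.of (P22.restrict T5 sa_T5 T5_sub)
  set R6 := KZ.of (P22.restrict T6 sa_T6 T6_sub)
  set W22a := KZ.of (wordRep ω22 1 adm_ω22); set W22b := KZ.of (wordRep ω22 2 adm_ω22)
  set W31a := KZ.of (wordRep ω31 1 adm_ω31); set W31b := KZ.of (wordRep ω31 2 adm_ω31)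
  set W31c := KZ.of (wordRep ω31 4 adm_ω31)
  have : cShuffle4 = (P - A - R1) + (R1 - B - R2) + (R2 - C - R3) + (R3 - D - R4) + (R4 - E - R5)
      + (R5 - F - R6) + R6 + (A - W22a) + (B - W31a) + (C - W31a) + (D - W31a) + (E - W31a)
      + (F - W22a) - (W22b - W22a - W22a) - (W31b - W31a - W31a) - (W31b - W31a - W31a)
      - (W31c - W31b - W31b) := by
    simp only [cShuffle4]; abel
  rw [this]
  exact sub_mem (sub_mem (sub_mem (sub_mem (add_mem (add_mem (add_mem (add_mem (add_mem (add_mem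
    (add_mem (add_mem (add_mem (add_mem (add_mem (add_mem p1 p2) p3) p4) p5) p6) p7) qA) qB) qC)
    qD) qE) qF) r22) r31a) r31a) r31b

/-! ## The finite double shuffle `ζ(4) = 4ζ(3,1)` inside the calculus -/

/-- **`ζ(4) = 4ζ(3,1)` IS A MOVE CHAIN**: `cFds4 = cShuffle4 − cStuffle4 ∈ KZ.relations`; the
product representation cancels, so the chain never uses the value `ζ(2)²`. [folklore] -/
theorem cFds4_mem_relations : cFds4 ∈ KZ.relations := by
  have : cFds4 = cShuffle4 - cStuffle4 := by
    simp only [cFds4, cShuffle4, cStuffle4]; abel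
  rw [this]
  exact sub_mem cShuffle4_mem_relations cStuffle4_mem_relations

/-- The chained description `1 > t₀ > t₁ > t₂ > t₃ > 0` of `Δ₄` (as inlined by route Grothendieck item 0275) is the simplex of the crux. [folklore] -/
theorem setOf_chain_eq_simplex :
    {t : Fin 4 → ℝ | 1 > t 0 ∧ t 0 > t 1 ∧ t 1 > t 2 ∧ t 2 > t 3 ∧ t 3 > 0} = simplex 4 := by
  ext t
  rw [mem_simplex_four]
  simp only [mem_setOf_eq, gt_iff_lt]
  constructor
  · rintro ⟨h0, h1, h2, h3, h4⟩
    exact ⟨⟨by linarith, by linarith, by linarith, h4⟩, ⟨h0, by linarith, by linarith, by linarith⟩,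
      ⟨h1, h2, h3⟩⟩
  · rintro ⟨⟨p0, p1, p2, p3⟩, ⟨l0, l1, l2, l3⟩, c1, c2, c3⟩
    exact ⟨l0, c1, c2, c3, p3⟩

/-! ## Consequences for the crux: the weight-4 rung is ONE typed membership -/

/-- **`WeightKernel 4 ⟺ cEuler4 ∈ KZ.relations`**: with duality one move (`Duality.lean`),
non-admissible words absorbed (`Divergence.lean`) and the finite double shuffle a move chain
(`cFds4_mem_relations`), the weight-4 rung of the crux is exactly Euler's evaluation
`3ζ(4) = 4ζ(2,2)` as a move chain. [folklore] -/
theorem weightKernel_four_iff_euler : WeightKernel 4 ↔ cEuler4 ∈ KZ.relations := by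
  rw [weightKernel_four_iff]
  exact ⟨fun h => h.2, fun h => ⟨cFds4_mem_relations, h⟩⟩

/-- Equivalently, the weight-4 rung is Hoffman's relation `ζ(4) = ζ(3,1) + ζ(2,2)` as a move
chain (the live instance of cruxes HoffmanRelationInKZ 3930 / CoactionDevissage 3167). [folklore] -/
theorem weightKernel_four_iff_hoffman : WeightKernel 4 ↔ cHoffman4 ∈ KZ.relations := by
  rw [weightKernel_iff_weightKernelAdm, weightKernelAdm_four_iff_fds_hoffman]
  exact ⟨fun h => h.2, fun h => ⟨cFds4_mem_relations, h⟩⟩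

/-- In the quotient: `[Δ₄, ω₀₀₁₁] ≡ [Δ₄, ¼ ω₀₀₀₁]` (`ζ(3,1) = ¼ζ(4)` inside the calculus). [folklore] -/
theorem of_wordRep_ω31_sub_mem :
    KZ.of (wordRep ω31 1 adm_ω31) - KZ.of (wordRep ω4 (1 / 4) adm_ω4) ∈ KZ.relations := by
  have h := of_wordRep_smul_of adm_ω4 adm_ω31 cFds4_mem_relations (1 / 4)
  norm_num at h
  simpa using KZ.relations.neg_mem h

end Summit.KontsevichZagierPeriods.MzvKernelInKZ.Negative
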